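import Summits.KontsevichZagierPeriods.KontsevichZagierPeriods.Theorems.ValuedFieldSpecialisationParametricLiftingStrata

/-!
# Route ValuedFieldSpecialisation — crux `ParametricLifting` (stmt-KontsevichZagierPeriods-3498):
# graded special-fibre rigidity on level 2 from `PlanarAreas` (lead c9, sub-goal W3)

Helper (`--supports stmt-KontsevichZagierPeriods-3498`) for line `registered`. Write level `E` :=
`AddSubgroup.closure {[r] | dim r < E}` and KL(`E`) := "every `x` on level `E` with `KZ.eval x = 0` is a
relation". Graded special-fibre rigidity SFG(`E`) says: if `Rᵢ → r₀ᵢ` are dominated families with fibres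
`r₀ᵢ` of dimension `d i < E` and `Σ mᵢ [Rᵢ]` is a fibred relation, then the special-fibre class
`Σ mᵢ [r₀ᵢ]` is a relation.

This file: `stub_specialFibreGraded_two_of_planarAreas` — **`PlanarAreas` ⇒ SFG(2)**. The hypothesis is
VERBATIM the shared item `LowDimension.PlanarAreas` (stmt-KontsevichZagierPeriods-4990: two planar
`ℚ`-semialgebraic sets of equal area are KZ-equivalent; Huber–Wüstholz transferred), which is KL(2) by the
tree theorem `kernelLevelTwo_iff_planarAreas` (`…ParametricLiftingStrata.lean`, lead c8). Then the three-step
argument: the value shadow `eval_specialFibre_eq_zero` (`…ParametricLiftingStrength.lean`) gives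
`KZ.eval (Σ mᵢ [r₀ᵢ]) = 0`; the class `Σ mᵢ [r₀ᵢ]` lies on level `2` because every `r₀ᵢ` has dimension
`d i < 2` (`AddSubgroup.sum_mem`, `AddSubgroup.zsmul_mem`, `AddSubgroup.subset_closure`); KL(2) concludes.

Sources: M. Kontsevich, D. Zagier, *Periods* (2001), §1.2, Conjecture 1; A. Huber, G. Wüstholz,
*Transcendence and linear relations of 1-periods* (2022), Thm. 13.3 (the level-2 input). The fibred /
dominated vocabulary is this route's (`KZFibredRelations.lean`, `KZDominatedFamily.lean`). No definitions.
-/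

noncomputable section

namespace Summit.KontsevichZagierPeriods.ValuedFieldSpecialisation

open MeasureTheory Set Filter
open scoped Topology
open Literature.NumberTheory.Transcendental

/-- **`PlanarAreas` ⇒ SFG(2)** (lead c9 sub-goal W3): if two planar `ℚ`-semialgebraic sets of equal area are
KZ-equivalent (item stmt-KontsevichZagierPeriods-4990, unfolded), then the special-fibre class `Σ mᵢ [r₀ᵢ]` of a
dominated net `Rᵢ → r₀ᵢ` with fibres of dimension `d i < 2`, whose total class `Σ mᵢ [Rᵢ]` is a fibred
relation, is a relation: `PlanarAreas` is the kernel conjecture on level `2` (`kernelLevelTwo_iff_planarAreas`),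
the class has value `0` (`eval_specialFibre_eq_zero`) and lies on level `2`.
[cite: KontsevichZagier2001, §1.2 Conjecture 1] -/
theorem stub_specialFibreGraded_two_of_planarAreas : (∀ (r r' : KZ.IntegralRep 2), (∀ p ∈ r.domain, r.integrand p = 1) → (∀ p ∈ r'.domain, r'.integrand p = 1) → r.value = r'.value → KZ.Equivalent r r') → ∀ (k : ℕ) (d : Fin k → ℕ) (m : Fin k → ℤ) (R : (i : Fin k) → KZ.IntegralRep (d i + 1)) (r₀ g : (i : Fin k) → KZ.IntegralRep (d i)), (∀ i, d i < 2) → (∀ i, KZ.IsDominatedFamily (R i) (r₀ i) (g i)) → (∑ i, m i • KZ.of (R i)) ∈ KZ.fibredRelations → (∑ i, m i • KZ.of (r₀ i)) ∈ KZ.relations := by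
  intro h k d m R r₀ g hd hR hG
  -- (1) `PlanarAreas` is KL(2)
  have hK : ∀ (x : KZ.FormalRep), x ∈ AddSubgroup.closure
      {y : KZ.FormalRep | ∃ (n : ℕ) (r : KZ.IntegralRep n), n < 2 ∧ y = KZ.of r} →
      KZ.eval x = 0 → x ∈ KZ.relations :=
    kernelLevelTwo_iff_planarAreas.mpr h
  -- (2) the value shadow, (4) KL(2)
  refine hK _ ?_ (eval_specialFibre_eq_zero m hR hG)
  -- (3) the special-fibre class lies on level `2`
  refine AddSubgroup.sum_mem _ fun i _ => AddSubgroup.zsmul_mem _ (AddSubgroup.subset_closure ?_) _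
  exact ⟨d i, r₀ i, hd i, rfl⟩

end Summit.KontsevichZagierPeriods.ValuedFieldSpecialisation
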